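import Literature.Geometry.Riemannian.LowEntropyHypersurfacesFourSurgery
import Literature.Geometry.Riemannian.MCFReparametrization
import HarnessLib

/-!
# Low-entropy hypersurfaces of `ℝ⁵`, Cor. 1.5 (b) of Chodosh–Mantoulidis–Schulze 2025 for `n = 4`:
# the round case needs no surgery, and the single-alternative minimal form of the reduction

Proofs companion of `LowEntropyHypersurfacesFourSurgery.lean` (theorems only). That file renders
the mean curvature flow with surgery of the printed proof of Cor. 1.5 (b) / Cor. 1.22 (b) of
O. Chodosh, C. Mantoulidis, F. Schulze, *Mean curvature flow with generic low-entropy initial data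
II*, Duke Math. J. 174 (2025), arXiv:2309.03856 (`n = 4`, simply connected `M`) as the structure
`Literature.Geometry.Riemannian.MCFSurgeryResolvableIn m M ι` and PROVES the reduction of the
named fact `Literature.Geometry.Riemannian.ChodoshMantoulidisSchulze2025_cor15b_four` to Cerf's
`Γ₄ = 0` and the minimal analytic hypothesis "for every closed connected embedded `ι : M⁴ ↪ ℝ⁵`
with `λ(ι(M)) ≤ λ(𝕊²(2) × ℝ²)`, either `range ι` is a round sphere or some map `M → ℝ⁵` is
resolved by a mean curvature flow with finitely many surgeries"
(`ChodoshMantoulidisSchulze2025_cor15b_four_of_mcfSurgery_of_cerf`), the round alternative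
mirroring "either `M` is a round sphere (in which case we are done)" of the printed proof (p. 6).

Here the round alternative is shown to be REDUNDANT: a round sphere, in any parametrisation over
any closed connected `M ≅ 𝕊⁴`, is itself resolved by the mean curvature flow with `0` surgeries —
the homothetically shrinking spheres of `ShrinkingSphereMCF.lean` transported along the
diffeomorphism `M ≅ 𝕊⁴`, a classical flow by the reparametrisation invariance of classical mean
curvature flows (`Literature.Geometry.Riemannian.IsClassicalMCF.comp_diffeomorph`,
`MCFReparametrization.lean`), followed by the discarding of the single piece `M ≅ 𝕊⁴` (the weak
`(α, δ, ℍ)`-flow of [DanielsHolgate2022, Example 3.21]). Consequently: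

* `mcfSurgeryResolvableIn_zero_sphere_comp` — for `e : M ≃ₘ 𝕊⁴`, the embedding `y ↦ e y` of `M`
  onto the unit sphere is resolved with no surgery;
* `exists_mcfSurgeryResolvableIn_zero_of_range_eq_sphere` — if `range ι` is a round sphere then
  some embedding of `M` is resolved with no surgery;
* `exists_mcfSurgeryResolvableIn_of_round_or`, `forall_exists_mcfSurgeryResolvableIn_of_round_or` —
  the round-or-resolvable hypothesis and the resolvable hypothesis are interchangeable;
* `ChodoshMantoulidisSchulze2025_cor15b_four_of_mcfSurgeryResolvable_of_cerf` — **the minimal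
  form of the reduction with a single alternative**: if every closed connected embedded
  `ι : M⁴ ↪ ℝ⁵` with `λ(ι(M)) ≤ λ(𝕊²(2) × ℝ²)` admits some map `M → ℝ⁵` resolved by a mean
  curvature flow with finitely many surgeries, then (given Cerf's theorem
  `Literature.Topology.FourManifolds.cerf_pi0Diff_sphere_three`) the named fact holds.

No named fact is introduced; what the named fact still rests on is unchanged (the analytic
statement — Thm. 1.13 of the cited paper with Daniels-Holgate 2022, Thm. 1.3 / Thm. 2.29 — and
Cerf 1968, Théorème 1), see the module docstring of `LowEntropyHypersurfacesFourSurgery.lean`.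

## References

* [ChodoshMantoulidisSchulze2025] O. Chodosh, C. Mantoulidis, F. Schulze, Duke Math. J. 174
  (2025), arXiv:2309.03856: Cor. 1.5 (b), Cor. 1.22 (b) and its proof (§1.6, p. 6).
* [DanielsHolgate2022] J. M. Daniels-Holgate, Adv. Math. 410 (2022) 108715, arXiv:2104.11647:
  Thm. 1.3, Thm. 2.29, §3 Example 3.21, Lemma 6.2, proof of Thm. 6.4.
* [Huisken1984] G. Huisken, J. Differential Geom. 20 (1984), §1 (shrinking spheres).
* [CerfDiffeoSphere1968] J. Cerf, LNM 53 (1968), Ch. I §1, Théorème 1.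
-/

noncomputable section

open Set Function Metric TopologicalSpace Filter
open scoped Manifold ContDiff Topology

namespace Literature.Geometry.Riemannian

open Literature.Topology.FourManifolds Lorentzian

/-! ### The round case needs no surgery, in any parametrisation -/

section RoundAny

variable {M : Type} [TopologicalSpace M] [T2Space M] [SecondCountableTopology M] [CompactSpace M]
  [ChartedSpace (EuclideanSpace ℝ (Fin 4)) M] [IsManifold (𝓡 4) ∞ M]

omit [T2Space M] [SecondCountableTopology M] [CompactSpace M] in
/-- A connected `C^∞` 4-manifold diffeomorphic to `𝕊⁴` is a finite union of pieces in the sense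
of `IsUnionOfPieces` (its one component is the first of Hamilton's pieces;
`IsUnionOfPieces.of_isConnectedSumOf`). [cite: DanielsHolgate2022, Thm. 2.29]
[cite: ChenZhu2006, Thm. 1.1 (iv) (p. 3)] -/
theorem isUnionOfPieces_of_nonempty_diffeomorph_sphere [ConnectedSpace M]
    (h : Nonempty (M ≃ₘ⟮𝓡 4, 𝓡 4⟯ (Metric.sphere (0 : EuclideanSpace ℝ (Fin 5)) 1))) :
    IsUnionOfPieces M :=
  IsUnionOfPieces.of_isConnectedSumOf
    (.piece (IsHamiltonPICPiece.of_nonempty_diffeomorph_sphere h))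

/-- **Transported shrinking spheres resolve `M ≅ 𝕊⁴` with no surgery.** For a diffeomorphism
`e : M ≃ₘ 𝕊⁴` of a closed connected `C^∞` 4-manifold, the embedding `y ↦ e y : M → ℝ⁵` onto the
unit sphere is the time-`0` slice of the classical mean curvature flow
`(t, y) ↦ √(1 - 8t) · e y` on `[0, 1/16]` — the homothetically shrinking spheres of
`ShrinkingSphereMCF.lean` (extinction time `1/8`) reparametrised along `e`, a classical flow by
the reparametrisation invariance `IsClassicalMCF.comp_diffeomorph` — after which the single
piece `M ≅ 𝕊⁴` is discarded (`isUnionOfPieces_of_nonempty_diffeomorph_sphere`): the weak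
`(α, δ, ℍ)`-flow "the shrinking sphere that vanishes once the mean curvature reaches `H_th`" of
[DanielsHolgate2022, Example 3.21], over an abstract parameter manifold.
[cite: DanielsHolgate2022, §3, Example 3.21] [cite: Huisken1984, §1] -/
theorem mcfSurgeryResolvableIn_zero_sphere_comp [ConnectedSpace M]
    (e : M ≃ₘ⟮𝓡 4, 𝓡 4⟯ (Metric.sphere (0 : EuclideanSpace ℝ (Fin 5)) 1)) :
    MCFSurgeryResolvableIn 0 M
      ((Subtype.val : Metric.sphere (0 : EuclideanSpace ℝ (Fin 5)) 1 → EuclideanSpace ℝ (Fin 5))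
        ∘ e) := by
  refine ⟨fun t ↦ shrinkingSphereFlowAt 4 0 (1 / 8) t ∘ e,
    fun t y ↦ shrinkingSphereNormalAt 4 0 (1 / 8) t (e y), 1 / 16, by norm_num,
    (isClassicalMCF_shrinkingSphereAt (n := 4) (by norm_num) (0 : EuclideanSpace ℝ (Fin 5)) (1 / 8)
      (by norm_num : (1 / 16 : ℝ) < 1 / 8)).comp_diffeomorph e, ?_,
    isUnionOfPieces_of_nonempty_diffeomorph_sphere ⟨e⟩⟩
  funext y
  simp only [Function.comp_apply, shrinkingSphereFlowAt, shrinkingSphereRadius, zero_add, sub_zero]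
  norm_num

/-- **The round case of the minimal hypothesis is resolvable with no surgery**: if the `C^∞`
embedding `ι : M → ℝ⁵` of the closed connected 4-manifold `M` has image a round sphere
`sphere c r`, `r > 0`, then some embedding of `M` into `ℝ⁵` — the diffeomorphism `M ≅ 𝕊⁴` of
`nonempty_diffeomorph_sphere_four_of_range_eq_sphere` followed by the inclusion — is resolved by a
mean curvature flow with `0` surgeries (`mcfSurgeryResolvableIn_zero_sphere_comp`). This is the
flow-with-surgery reading of "either `M` is a round sphere (in which case we are done)" in the
proof of Cor. 1.22 (p. 6). [cite: ChodoshMantoulidisSchulze2025, Cor. 1.22, proof (round case)]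
[cite: DanielsHolgate2022, §3, Example 3.21] -/
theorem exists_mcfSurgeryResolvableIn_zero_of_range_eq_sphere [ConnectedSpace M]
    {ι : M → EuclideanSpace ℝ (Fin 5)} (hι : Manifold.IsSmoothEmbedding (𝓡 4) (𝓡 5) ∞ ι)
    {c : EuclideanSpace ℝ (Fin 5)} {r : ℝ} (hr : 0 < r) (hrange : range ι = Metric.sphere c r) :
    ∃ ι₁ : M → EuclideanSpace ℝ (Fin 5), MCFSurgeryResolvableIn 0 M ι₁ := by
  obtain ⟨e⟩ := nonempty_diffeomorph_sphere_four_of_range_eq_sphere M hι hr hrange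
  exact ⟨_, mcfSurgeryResolvableIn_zero_sphere_comp e⟩

/-- **The round alternative of the minimal hypothesis is redundant**: for a `C^∞` embedding `ι`
of the closed connected `M` into `ℝ⁵`, "`range ι` is a round sphere, or some map `M → ℝ⁵` is
resolved by a mean curvature flow with finitely many surgeries" already implies the second
alternative (`exists_mcfSurgeryResolvableIn_zero_of_range_eq_sphere`).
[cite: ChodoshMantoulidisSchulze2025, Cor. 1.22, proof (round case)] -/
theorem exists_mcfSurgeryResolvableIn_of_round_or [ConnectedSpace M]
    {ι : M → EuclideanSpace ℝ (Fin 5)} (hι : Manifold.IsSmoothEmbedding (𝓡 4) (𝓡 5) ∞ ι)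
    (h : (∃ (c : EuclideanSpace ℝ (Fin 5)) (r : ℝ), 0 < r ∧ range ι = Metric.sphere c r) ∨
      ∃ (ι₁ : M → EuclideanSpace ℝ (Fin 5)) (m : ℕ), MCFSurgeryResolvableIn m M ι₁) :
    ∃ (ι₁ : M → EuclideanSpace ℝ (Fin 5)) (m : ℕ), MCFSurgeryResolvableIn m M ι₁ := by
  rcases h with ⟨c, r, hr, hrange⟩ | h
  · obtain ⟨ι₁, h₁⟩ := exists_mcfSurgeryResolvableIn_zero_of_range_eq_sphere hι hr hrange
    exact ⟨ι₁, 0, h₁⟩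
  · exact h

end RoundAny

/-! ### The minimal form of the reduction, with a single alternative -/

section Minimal

/-- **Cor. 1.5 (b) / Cor. 1.22 (b) for `n = 4` (simply connected case) from the mean curvature
flow with surgery and Cerf's `Γ₄ = 0` — minimal form, single alternative.** If every closed
connected embedded `ι : M⁴ ↪ ℝ⁵` with `λ(ι(M)) ≤ λ(𝕊²(2) × ℝ²)` admits SOME map `ι₁ : M → ℝ⁵`
resolved by a mean curvature flow with finitely many surgeries (`MCFSurgeryResolvableIn m M ι₁`),
then the named fact `ChodoshMantoulidisSchulze2025_cor15b_four` holds
(`MCFSurgeryResolvableIn.nonempty_diffeomorph_sphere`). By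
`exists_mcfSurgeryResolvableIn_of_round_or` this hypothesis is EQUIVALENT, embedding by
embedding, to that of `ChodoshMantoulidisSchulze2025_cor15b_four_of_mcfSurgery_of_cerf` (whose
round alternative — "either `M` is a round sphere (in which case we are done)", proof of
Cor. 1.22, p. 6 — is resolvable with no surgery), and it is implied by the printed-shape
hypothesis of `ChodoshMantoulidisSchulze2025_cor15b_four_of_perturbedSurgeryFlow_of_cerf`
(Thm. 1.13 / Cor. 1.19 of the cited paper followed by Daniels-Holgate 2022, Thm. 1.3), whose
proof — the Brakke-flow analysis of the two papers — is what the named fact still rests on,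
together with Cerf's theorem.
[cite: ChodoshMantoulidisSchulze2025, Cor. 1.5 (b), Cor. 1.22 (b) and proof (§1.6, p. 6)]
[cite: DanielsHolgate2022, Thm. 1.3, Lemma 6.2, proof of Thm. 6.4]
[cite: CerfDiffeoSphere1968, Ch. I §1, Théorème 1] -/
theorem ChodoshMantoulidisSchulze2025_cor15b_four_of_mcfSurgeryResolvable_of_cerf
    (hflow : ∀ (M : Type) [TopologicalSpace M] [T2Space M] [SecondCountableTopology M]
      [CompactSpace M] [ConnectedSpace M] [ChartedSpace (EuclideanSpace ℝ (Fin 4)) M]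
      [IsManifold (𝓡 4) ∞ M]
      (ι : M → EuclideanSpace ℝ (Fin 5)), Manifold.IsSmoothEmbedding (𝓡 4) (𝓡 5) ∞ ι →
      gaussianEntropy 4 (range ι) ≤ gaussianEntropy 4 (shrinkingCylinder 4 2) →
      ∃ (ι₁ : M → EuclideanSpace ℝ (Fin 5)) (m : ℕ), MCFSurgeryResolvableIn m M ι₁)
    (hcerf : cerf_pi0Diff_sphere_three) :
    ChodoshMantoulidisSchulze2025_cor15b_four :=
  ChodoshMantoulidisSchulze2025_cor15b_four_of_mcfSurgery_of_cerf
    (fun M _ _ _ _ _ _ _ ι hι hent ↦ Or.inr (hflow M ι hι hent)) hcerf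

/-- Conversely, the round-or-resolvable hypothesis of
`ChodoshMantoulidisSchulze2025_cor15b_four_of_mcfSurgery_of_cerf` yields the single-alternative
one (`exists_mcfSurgeryResolvableIn_of_round_or`, embedding by embedding), so that the two
minimal forms have interchangeable hypotheses.
[cite: ChodoshMantoulidisSchulze2025, Cor. 1.22, proof (round case)] -/
theorem forall_exists_mcfSurgeryResolvableIn_of_round_or
    (hflow : ∀ (M : Type) [TopologicalSpace M] [T2Space M] [SecondCountableTopology M]
      [CompactSpace M] [ConnectedSpace M] [ChartedSpace (EuclideanSpace ℝ (Fin 4)) M]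
      [IsManifold (𝓡 4) ∞ M]
      (ι : M → EuclideanSpace ℝ (Fin 5)), Manifold.IsSmoothEmbedding (𝓡 4) (𝓡 5) ∞ ι →
      gaussianEntropy 4 (range ι) ≤ gaussianEntropy 4 (shrinkingCylinder 4 2) →
      (∃ (c : EuclideanSpace ℝ (Fin 5)) (r : ℝ), 0 < r ∧ range ι = Metric.sphere c r) ∨
      ∃ (ι₁ : M → EuclideanSpace ℝ (Fin 5)) (m : ℕ), MCFSurgeryResolvableIn m M ι₁)
    (M : Type) [TopologicalSpace M] [T2Space M] [SecondCountableTopology M]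
    [CompactSpace M] [ConnectedSpace M] [ChartedSpace (EuclideanSpace ℝ (Fin 4)) M]
    [IsManifold (𝓡 4) ∞ M]
    (ι : M → EuclideanSpace ℝ (Fin 5)) (hι : Manifold.IsSmoothEmbedding (𝓡 4) (𝓡 5) ∞ ι)
    (hent : gaussianEntropy 4 (range ι) ≤ gaussianEntropy 4 (shrinkingCylinder 4 2)) :
    ∃ (ι₁ : M → EuclideanSpace ℝ (Fin 5)) (m : ℕ), MCFSurgeryResolvableIn m M ι₁ :=
  exists_mcfSurgeryResolvableIn_of_round_or hι (hflow M ι hι hent)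

end Minimal

end Literature.Geometry.Riemannian

end
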